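import Summits.CriticalPhenomena.PercolationContinuityZ3.Theorems.PercNearOneGluingNoHeavyLowerTailTformWitnessSeparatedTools
import Literature.Probability.LatticeModels.ProdBernoulliLocallyMonotoneFKG
import HarnessLib

/-!
# `NoHeavyLowerTail` (stmt-CriticalPhenomena-4575) — T-form gluing across a separating witness relay: the rows

Support file (prover `prim-hp-1`; `--supports stmt-CriticalPhenomena-4575`).  No definitions, no named facts, no sorries.
Part 2 of 3.  `μ = prodBernoulli w` on `Fin n`, relays `A`, level `j`, `N_x = |{a ∈ A : x ↔ a}|`; a relay `c` and pairwise
disjoint, pairwise non-adjacent sides `V l` covering the other vertices.  The four CONDITIONAL-HARRIS ROWS behind the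
witness-separated gluing rule, each an instance of Kesten/Nolin's locally monotone FKG inequality with `S` = the loop-free
pairs of the observer's side: `core_heavyLight` / `core_attLight` (for `x` on side `i` and a decreasing, resp. increasing,
event `B` determined off that side: `μ(B)·μ{N_x > j, N_c ≤ j} ≤ μ(B ∩ {…})`, resp. with `{1 ≤ N_x ≤ j, N_c > j}`; on the
support event `{N_x > j, N_c ≤ j} = {x heavy inside its side} ∩ {c light}` — this is where separation is used), and the
instances `B = {c ↮ y}` (`inter_notReach_heavyLight_ge`, `inter_notReach_attLight_le`) and `B = {x ↮ A}`
(`inter_unattached_heavyLight_ge`, `inter_unattached_attLight_le`).  Without separation these localizations are FALSE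
(crux memo HULLPORT-COUPLING.md §28). [cite: Nolin2008, §4.3 Lemma 13 (locally monotone FKG)]
-/

noncomputable section

namespace Summit.CriticalPhenomena.PercolationContinuityZ3.Theorems

open MeasureTheory Set Literature.Probability.LatticeModels Literature.Probability.Percolation
open scoped Classical BigOperators

variable {n : ℕ}

namespace WitnessSeparated

open CutObserver CutObserver.SteinerPorts

/-! ### The conditional-Harris rows -/

section Rows

variable (w : Sym2 (Fin n) → unitInterval) (A : Finset (Fin n)) (j : ℕ) (c : Fin n)
  {d : ℕ} (V : Fin d → Finset (Fin n))

/-- **Core row (heavy/light side).**  For `x ∈ V i` and a DECREASING event `B` determined by the loop-free pairs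
off the side of `x` (coordinates outside the loop-free pairs of `insert c (V i)`):
`μ(B) · μ{N_x > j, N_c ≤ j} ≤ μ(B ∩ {N_x > j, N_c ≤ j})`.
[cite: Nolin2008, §4.3 Lemma 13] -/
theorem core_heavyLight (hcover : ∀ x, x ≠ c → ∃ l, x ∈ V l)
    (hsep : ∀ l l', l ≠ l' → ∀ x ∈ V l, ∀ y ∈ V l', w s(x, y) = 0)
    (i : Fin d) {x : Fin n} (hx : x ∈ V i)
    {B : Set (BondConfig (Fin n))} (hB : IsLowerSet B)
    (dB : DeterminedBy B (↑(Finset.univ \ (insert c (V i)).sym2.erase s(c, c)) : Set (Sym2 (Fin n)))) :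
    (prodBernoulli w).real B *
        (prodBernoulli w).real {ω : BondConfig (Fin n) |
          j < (A.filter fun a => ω ∈ openConn x a).card ∧ (A.filter fun a => ω ∈ openConn c a).card ≤ j} ≤
      (prodBernoulli w).real (B ∩ {ω : BondConfig (Fin n) |
          j < (A.filter fun a => ω ∈ openConn x a).card ∧ (A.filter fun a => ω ∈ openConn c a).card ≤ j}) := by
  set μ := prodBernoulli w with hμ
  haveI : IsProbabilityMeasure μ := by rw [hμ]; infer_instance
  set E : Finset (Sym2 (Fin n)) := (insert c (V i)).sym2.erase s(c, c) with hE
  set Ap : Set (BondConfig (Fin n)) :=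
    {ω | j < (A.filter fun a => (openGraph (ω ∩ ↑E)).Reachable x a).card} with hAp
  set Am : Set (BondConfig (Fin n)) := {ω | (A.filter fun a => ω ∈ openConn c a).card ≤ j} with hAm
  set G : Set (BondConfig (Fin n)) :=
    {ω | j < (A.filter fun a => ω ∈ openConn x a).card ∧ (A.filter fun a => ω ∈ openConn c a).card ≤ j}
    with hGdef
  -- (1) on the support event, `G = Ap ∩ Am`
  have hiff : ∀ ω : BondConfig (Fin n), (∀ e ∈ ω, w e ≠ 0) → (ω ∈ G ↔ ω ∈ Ap ∩ Am) := by
    intro ω hω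
    simp only [hGdef, hAp, hAm, mem_setOf_eq, mem_inter_iff]
    constructor
    · rintro ⟨h1, h2⟩
      refine ⟨?_, h2⟩
      have hnot : ¬ (openGraph ω).Reachable x c := fun hxc => by
        rw [card_eq_of_reachable A hxc] at h1; omega
      have e1 : (A.filter fun a => ω ∈ openConn x a) =
          (A.filter fun a => (openGraph (ω ∩ ↑E)).Reachable x a) :=
        Finset.filter_congr fun a _ => by
          simp only [openConn, mem_setOf_eq]
          exact reach_side_iff w c V hcover hsep ω hω i hx hnot a
      rw [← e1]; exact h1
    · rintro ⟨h1, h2⟩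
      refine ⟨lt_of_lt_of_le h1 (Finset.card_le_card fun a ha => ?_), h2⟩
      rw [Finset.mem_filter] at ha ⊢
      refine ⟨ha.1, ?_⟩
      simp only [openConn, mem_setOf_eq]
      exact reachable_mono inter_subset_left ha.2
  have hG_eq : μ.real G = μ.real (Ap ∩ Am) := measureReal_congr_support w hiff
  have hBG_eq : μ.real (B ∩ G) = μ.real (B ∩ (Ap ∩ Am)) :=
    measureReal_congr_support w fun ω hω => by
      simp only [mem_inter_iff]
      rw [← mem_inter_iff ω Ap Am, ← hiff ω hω]
  -- (2) the locally monotone FKG inequality with `S = E`, `M = univ \ E`, `P = ∅`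
  have hSM : Disjoint E (Finset.univ \ E) := Finset.disjoint_sdiff
  have hAp_up : IsUpperSet Ap := fun ω ω' hle h => lt_of_lt_of_le h (card_inter_mono A (↑E) x hle)
  have hAm_low : IsLowerSet Am := fun ω ω' hle h => le_trans (card_mono A c hle) h
  have dAp : DeterminedBy Ap (↑E ∪ ↑(∅ : Finset (Sym2 (Fin n)))) :=
    (determinedBy_readOff (↑E : Set (Sym2 (Fin n))) (fun ξ => j < (A.filter fun a => (openGraph ξ).Reachable x a).card)).mono
      subset_union_left
  have dAm : DeterminedBy Am (↑E ∪ ↑(Finset.univ \ E)) := determinedBy_union_compl Am E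
  have dB' : DeterminedBy B (↑(Finset.univ \ E) : Set (Sym2 (Fin n))) := dB
  have key := prodBernoulli_locallyMonotone_fkg w (S := E) (P := ∅) (M := Finset.univ \ E)
    (Finset.disjoint_empty_right E) hSM (Finset.disjoint_empty_left _)
    hAp_up hAm_low isUpperSet_univ hB dAp dAm (determinedBy_univ _) dB'
  rw [probReal_univ, one_mul, univ_inter] at key
  -- (3) assemble
  rw [hG_eq, hBG_eq, mul_comm]
  calc μ.real (Ap ∩ Am) * μ.real B ≤ μ.real (Ap ∩ Am ∩ B) := key
    _ = μ.real (B ∩ (Ap ∩ Am)) := by rw [inter_comm]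

/-- **Core row (attached-light/heavy side).**  For `x ∈ V i` and an INCREASING event `B` determined by the
pairs off the side of `x`:  `μ(B) · μ{1 ≤ N_x ≤ j, N_c > j} ≤ μ(B ∩ {1 ≤ N_x ≤ j, N_c > j})`.
[cite: Nolin2008, §4.3 Lemma 13] -/
theorem core_attLight (hcV : ∀ l, c ∉ V l) (hdisj : ∀ l l', l ≠ l' → Disjoint (V l) (V l'))
    (hcover : ∀ x, x ≠ c → ∃ l, x ∈ V l)
    (hsep : ∀ l l', l ≠ l' → ∀ x ∈ V l, ∀ y ∈ V l', w s(x, y) = 0)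
    (i : Fin d) {x : Fin n} (hx : x ∈ V i)
    {B : Set (BondConfig (Fin n))} (hB : IsUpperSet B)
    (dB : DeterminedBy B (↑(Finset.univ \ (insert c (V i)).sym2.erase s(c, c)) : Set (Sym2 (Fin n)))) :
    (prodBernoulli w).real B *
        (prodBernoulli w).real {ω : BondConfig (Fin n) |
          1 ≤ (A.filter fun a => ω ∈ openConn x a).card ∧ (A.filter fun a => ω ∈ openConn x a).card ≤ j ∧
            j < (A.filter fun a => ω ∈ openConn c a).card} ≤
      (prodBernoulli w).real (B ∩ {ω : BondConfig (Fin n) |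
          1 ≤ (A.filter fun a => ω ∈ openConn x a).card ∧ (A.filter fun a => ω ∈ openConn x a).card ≤ j ∧
            j < (A.filter fun a => ω ∈ openConn c a).card}) := by
  set μ := prodBernoulli w with hμ
  haveI : IsProbabilityMeasure μ := by rw [hμ]; infer_instance
  set E : Finset (Sym2 (Fin n)) := (insert c (V i)).sym2.erase s(c, c) with hE
  set Ap : Set (BondConfig (Fin n)) :=
    {ω | 1 ≤ (A.filter fun a => (openGraph (ω ∩ ↑E)).Reachable x a).card} ∩
      {ω | j < (A.filter fun a => ω ∈ openConn c a).card} with hAp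
  set Am : Set (BondConfig (Fin n)) :=
    {ω | (A.filter fun a => (openGraph (ω ∩ ↑E)).Reachable x a).card ≤ j} ∩
      {ω | ¬ (openGraph (ω ∩ ↑E)).Reachable x c} with hAm
  set G : Set (BondConfig (Fin n)) :=
    {ω | 1 ≤ (A.filter fun a => ω ∈ openConn x a).card ∧ (A.filter fun a => ω ∈ openConn x a).card ≤ j ∧
      j < (A.filter fun a => ω ∈ openConn c a).card} with hGdef
  -- (1) on the support event, `G = Ap ∩ Am`
  have hiff : ∀ ω : BondConfig (Fin n), (∀ e ∈ ω, w e ≠ 0) → (ω ∈ G ↔ ω ∈ Ap ∩ Am) := by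
    intro ω hω
    simp only [hGdef, hAp, hAm, mem_setOf_eq, mem_inter_iff]
    constructor
    · rintro ⟨h1, h2, h3⟩
      have hnot : ¬ (openGraph ω).Reachable x c := fun hxc => by
        rw [card_eq_of_reachable A hxc] at h2; omega
      have e1 : (A.filter fun a => ω ∈ openConn x a) =
          (A.filter fun a => (openGraph (ω ∩ ↑E)).Reachable x a) :=
        Finset.filter_congr fun a _ => by
          simp only [openConn, mem_setOf_eq]
          exact reach_side_iff w c V hcover hsep ω hω i hx hnot a
      rw [e1] at h1 h2
      exact ⟨⟨h1, h3⟩, h2, fun h => hnot (reachable_mono inter_subset_left h)⟩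
    · rintro ⟨⟨h1, h3⟩, h2, h4⟩
      have hnot : ¬ (openGraph ω).Reachable x c :=
        fun hxc => h4 (sideReach_cut_of_reach w c V hcV hdisj hcover hsep ω hω i hx hxc)
      have e1 : (A.filter fun a => ω ∈ openConn x a) =
          (A.filter fun a => (openGraph (ω ∩ ↑E)).Reachable x a) :=
        Finset.filter_congr fun a _ => by
          simp only [openConn, mem_setOf_eq]
          exact reach_side_iff w c V hcover hsep ω hω i hx hnot a
      rw [e1]
      exact ⟨h1, h2, h3⟩
  have hG_eq : μ.real G = μ.real (Ap ∩ Am) := measureReal_congr_support w hiff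
  have hBG_eq : μ.real (B ∩ G) = μ.real (B ∩ (Ap ∩ Am)) :=
    measureReal_congr_support w fun ω hω => by
      simp only [mem_inter_iff]
      rw [← mem_inter_iff ω Ap Am, ← hiff ω hω]
  -- (2) the locally monotone FKG inequality with `S = E`, `P = univ \ E`, `M = ∅`
  have hSP : Disjoint E (Finset.univ \ E) := Finset.disjoint_sdiff
  have hAp_up : IsUpperSet Ap := by
    intro ω ω' hle h
    exact ⟨le_trans h.1 (card_inter_mono A (↑E) x hle), lt_of_lt_of_le h.2 (card_mono A c hle)⟩
  have hAm_low : IsLowerSet Am := by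
    intro ω ω' hle h
    exact ⟨le_trans (card_inter_mono A (↑E) x hle) h.1, fun h' => h.2 (reach_inter_mono (↑E) hle h')⟩
  have dAp : DeterminedBy Ap (↑E ∪ ↑(Finset.univ \ E)) := determinedBy_union_compl Ap E
  have dAm : DeterminedBy Am (↑E ∪ ↑(∅ : Finset (Sym2 (Fin n)))) :=
    ((determinedBy_readOff (↑E : Set (Sym2 (Fin n))) (fun ξ => (A.filter fun a => (openGraph ξ).Reachable x a).card ≤ j)).inter
      (determinedBy_readOff (↑E : Set (Sym2 (Fin n))) (fun ξ => ¬ (openGraph ξ).Reachable x c))).mono subset_union_left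
  have dB' : DeterminedBy B (↑(Finset.univ \ E) : Set (Sym2 (Fin n))) := dB
  have key := prodBernoulli_locallyMonotone_fkg w (S := E) (P := Finset.univ \ E) (M := ∅)
    hSP (Finset.disjoint_empty_right E) (Finset.disjoint_empty_right _)
    hAp_up hAm_low hB isLowerSet_univ dAp dAm dB' (determinedBy_univ _)
  rw [probReal_univ, mul_one, inter_univ] at key
  rw [hG_eq, hBG_eq, mul_comm]
  calc μ.real (Ap ∩ Am) * μ.real B ≤ μ.real (Ap ∩ Am ∩ B) := key
    _ = μ.real (B ∩ (Ap ∩ Am)) := by rw [inter_comm]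

/-- **Row 1.**  For `x ∈ V i`, `y ∈ V i'` (`i ≠ i'`):  `μ{c ↮ y} · μ{N_x > j, N_c ≤ j} ≤ μ({c ↮ y} ∩ {N_x > j, N_c ≤ j})`.
[cite: Nolin2008, §4.3 Lemma 13] -/
theorem inter_notReach_heavyLight_ge (hcV : ∀ l, c ∉ V l) (hdisj : ∀ l l', l ≠ l' → Disjoint (V l) (V l'))
    (hcover : ∀ x, x ≠ c → ∃ l, x ∈ V l)
    (hsep : ∀ l l', l ≠ l' → ∀ x ∈ V l, ∀ y ∈ V l', w s(x, y) = 0)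
    (i i' : Fin d) (hii' : i ≠ i') {x y : Fin n} (hx : x ∈ V i) (hy : y ∈ V i') :
    (prodBernoulli w).real {ω : BondConfig (Fin n) | ω ∉ openConn c y} *
        (prodBernoulli w).real {ω : BondConfig (Fin n) |
          j < (A.filter fun a => ω ∈ openConn x a).card ∧ (A.filter fun a => ω ∈ openConn c a).card ≤ j} ≤
      (prodBernoulli w).real ({ω : BondConfig (Fin n) | ω ∉ openConn c y} ∩ {ω : BondConfig (Fin n) |
          j < (A.filter fun a => ω ∈ openConn x a).card ∧ (A.filter fun a => ω ∈ openConn c a).card ≤ j}) := by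
  set E' : Finset (Sym2 (Fin n)) := (insert c (V i')).sym2.erase s(c, c) with hE'
  set Bs : Set (BondConfig (Fin n)) := {ω | ¬ (openGraph (ω ∩ ↑E')).Reachable c y} with hBs
  have hiff : ∀ ω : BondConfig (Fin n), (∀ e ∈ ω, w e ≠ 0) →
      (ω ∈ {ω : BondConfig (Fin n) | ω ∉ openConn c y} ↔ ω ∈ Bs) := by
    intro ω hω
    simp only [hBs, mem_setOf_eq, openConn]
    rw [reach_cut_iff w c V hcV hdisj hcover hsep ω hω i' hy]
  have e1 : (prodBernoulli w).real {ω : BondConfig (Fin n) | ω ∉ openConn c y} = (prodBernoulli w).real Bs :=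
    measureReal_congr_support w hiff
  have e2 : (prodBernoulli w).real ({ω : BondConfig (Fin n) | ω ∉ openConn c y} ∩ {ω : BondConfig (Fin n) |
          j < (A.filter fun a => ω ∈ openConn x a).card ∧ (A.filter fun a => ω ∈ openConn c a).card ≤ j}) =
      (prodBernoulli w).real (Bs ∩ {ω : BondConfig (Fin n) |
          j < (A.filter fun a => ω ∈ openConn x a).card ∧ (A.filter fun a => ω ∈ openConn c a).card ≤ j}) :=
    measureReal_congr_support w fun ω hω => by
      simp only [mem_inter_iff]
      rw [hiff ω hω]
  have hBs_low : IsLowerSet Bs := by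
    intro ω ω' hle h
    simp only [hBs, mem_setOf_eq] at h ⊢
    exact fun h' => h (reach_inter_mono _ hle h')
  have dBs : DeterminedBy Bs (↑E' : Set (Sym2 (Fin n))) :=
    determinedBy_readOff (↑E' : Set (Sym2 (Fin n))) (fun ξ => ¬ (openGraph ξ).Reachable c y)
  have dBs' := determinedBy_offBlock c V hdisj hii' dBs
  rw [e1, e2]
  exact core_heavyLight w A j c V hcover hsep i hx hBs_low dBs'

/-- **Row 2.**  For `x ∈ V i`, `y ∈ V i'` (`i ≠ i'`):
`μ({c ↮ y} ∩ {1 ≤ N_x ≤ j, N_c > j}) ≤ μ{c ↮ y} · μ{1 ≤ N_x ≤ j, N_c > j}`. [cite: Nolin2008, §4.3 Lemma 13] -/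
theorem inter_notReach_attLight_le (hcV : ∀ l, c ∉ V l) (hdisj : ∀ l l', l ≠ l' → Disjoint (V l) (V l'))
    (hcover : ∀ x, x ≠ c → ∃ l, x ∈ V l)
    (hsep : ∀ l l', l ≠ l' → ∀ x ∈ V l, ∀ y ∈ V l', w s(x, y) = 0)
    (i i' : Fin d) (hii' : i ≠ i') {x y : Fin n} (hx : x ∈ V i) (hy : y ∈ V i') :
    (prodBernoulli w).real ({ω : BondConfig (Fin n) | ω ∉ openConn c y} ∩ {ω : BondConfig (Fin n) |
          1 ≤ (A.filter fun a => ω ∈ openConn x a).card ∧ (A.filter fun a => ω ∈ openConn x a).card ≤ j ∧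
            j < (A.filter fun a => ω ∈ openConn c a).card}) ≤
      (prodBernoulli w).real {ω : BondConfig (Fin n) | ω ∉ openConn c y} *
        (prodBernoulli w).real {ω : BondConfig (Fin n) |
          1 ≤ (A.filter fun a => ω ∈ openConn x a).card ∧ (A.filter fun a => ω ∈ openConn x a).card ≤ j ∧
            j < (A.filter fun a => ω ∈ openConn c a).card} := by
  set μ := prodBernoulli w with hμ
  haveI : IsProbabilityMeasure μ := by rw [hμ]; infer_instance
  set E' : Finset (Sym2 (Fin n)) := (insert c (V i')).sym2.erase s(c, c) with hE'
  set Bs : Set (BondConfig (Fin n)) := {ω | (openGraph (ω ∩ ↑E')).Reachable c y} with hBs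
  set Br : Set (BondConfig (Fin n)) := {ω | ω ∈ openConn c y} with hBr
  set G : Set (BondConfig (Fin n)) := {ω : BondConfig (Fin n) |
    1 ≤ (A.filter fun a => ω ∈ openConn x a).card ∧ (A.filter fun a => ω ∈ openConn x a).card ≤ j ∧
      j < (A.filter fun a => ω ∈ openConn c a).card} with hGdef
  have hiff : ∀ ω : BondConfig (Fin n), (∀ e ∈ ω, w e ≠ 0) → (ω ∈ Br ↔ ω ∈ Bs) := by
    intro ω hω
    simp only [hBs, hBr, mem_setOf_eq, openConn]
    exact reach_cut_iff w c V hcV hdisj hcover hsep ω hω i' hy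
  have e1 : μ.real Br = μ.real Bs := measureReal_congr_support w hiff
  have e2 : μ.real (Br ∩ G) = μ.real (Bs ∩ G) :=
    measureReal_congr_support w fun ω hω => by simp only [mem_inter_iff]; rw [hiff ω hω]
  have hBs_up : IsUpperSet Bs := by
    intro ω ω' hle h
    simp only [hBs, mem_setOf_eq] at h ⊢
    exact reach_inter_mono _ hle h
  have dBs : DeterminedBy Bs (↑E' : Set (Sym2 (Fin n))) :=
    determinedBy_readOff (↑E' : Set (Sym2 (Fin n))) (fun ξ => (openGraph ξ).Reachable c y)
  have dBs' := determinedBy_offBlock c V hdisj hii' dBs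
  have hcore : μ.real Br * μ.real G ≤ μ.real (Br ∩ G) := by
    rw [e1, e2]
    exact core_attLight w A j c V hcV hdisj hcover hsep i hx hBs_up dBs'
  -- complement bookkeeping
  have hsplit : μ.real (G ∩ Br) + μ.real (G \ Br) = μ.real G :=
    measureReal_inter_add_sdiff MeasurableSet.of_discrete
  have hcompl : μ.real {ω : BondConfig (Fin n) | ω ∉ openConn c y} = 1 - μ.real Br := by
    have h := measureReal_compl (μ := μ) (s := Br) MeasurableSet.of_discrete
    rw [probReal_univ] at h
    rw [← h]
    congr 1
  have hdiff : ({ω : BondConfig (Fin n) | ω ∉ openConn c y} ∩ G) = G \ Br := by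
    ext ω; simp only [mem_inter_iff, mem_sdiff, mem_setOf_eq, hBr]; tauto
  rw [hdiff, hcompl]
  rw [inter_comm] at hcore
  have hring : (1 - μ.real Br) * μ.real G = μ.real G - μ.real Br * μ.real G := by ring
  rw [hring]
  linarith [hcore, hsplit]

/-- **Row 3.**  For `x ∈ V i`, `y ∈ V i'` (`i ≠ i'`) and the cut relay `c ∈ A`:
`μ{x ↮ A} · μ{N_y > j, N_c ≤ j} ≤ μ({x ↮ A} ∩ {N_y > j, N_c ≤ j})`. [cite: Nolin2008, §4.3 Lemma 13] -/
theorem inter_unattached_heavyLight_ge (hcA : c ∈ A) (hcV : ∀ l, c ∉ V l)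
    (hdisj : ∀ l l', l ≠ l' → Disjoint (V l) (V l'))
    (hcover : ∀ x, x ≠ c → ∃ l, x ∈ V l)
    (hsep : ∀ l l', l ≠ l' → ∀ x ∈ V l, ∀ y ∈ V l', w s(x, y) = 0)
    (i i' : Fin d) (hii' : i ≠ i') {x y : Fin n} (hx : x ∈ V i) (hy : y ∈ V i') :
    (prodBernoulli w).real {ω : BondConfig (Fin n) | ∀ a ∈ A, ω ∉ openConn x a} *
        (prodBernoulli w).real {ω : BondConfig (Fin n) |
          j < (A.filter fun a => ω ∈ openConn y a).card ∧ (A.filter fun a => ω ∈ openConn c a).card ≤ j} ≤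
      (prodBernoulli w).real ({ω : BondConfig (Fin n) | ∀ a ∈ A, ω ∉ openConn x a} ∩ {ω : BondConfig (Fin n) |
          j < (A.filter fun a => ω ∈ openConn y a).card ∧ (A.filter fun a => ω ∈ openConn c a).card ≤ j}) := by
  set E : Finset (Sym2 (Fin n)) := (insert c (V i)).sym2.erase s(c, c) with hE
  set Bs : Set (BondConfig (Fin n)) := {ω | ∀ a ∈ A, ¬ (openGraph (ω ∩ ↑E)).Reachable x a} with hBs
  have hiff : ∀ ω : BondConfig (Fin n), (∀ e ∈ ω, w e ≠ 0) →
      (ω ∈ {ω : BondConfig (Fin n) | ∀ a ∈ A, ω ∉ openConn x a} ↔ ω ∈ Bs) := by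
    intro ω hω
    simp only [hBs, mem_setOf_eq]
    exact unattached_iff w c V A hcA hcV hdisj hcover hsep ω hω i hx
  have e1 : (prodBernoulli w).real {ω : BondConfig (Fin n) | ∀ a ∈ A, ω ∉ openConn x a} =
      (prodBernoulli w).real Bs := measureReal_congr_support w hiff
  have e2 : (prodBernoulli w).real ({ω : BondConfig (Fin n) | ∀ a ∈ A, ω ∉ openConn x a} ∩
        {ω : BondConfig (Fin n) |
          j < (A.filter fun a => ω ∈ openConn y a).card ∧ (A.filter fun a => ω ∈ openConn c a).card ≤ j}) =
      (prodBernoulli w).real (Bs ∩ {ω : BondConfig (Fin n) |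
          j < (A.filter fun a => ω ∈ openConn y a).card ∧ (A.filter fun a => ω ∈ openConn c a).card ≤ j}) :=
    measureReal_congr_support w fun ω hω => by simp only [mem_inter_iff]; rw [hiff ω hω]
  have hBs_low : IsLowerSet Bs := by
    intro ω ω' hle h
    simp only [hBs, mem_setOf_eq] at h ⊢
    exact fun a ha h' => h a ha (reach_inter_mono _ hle h')
  have dBs : DeterminedBy Bs (↑E : Set (Sym2 (Fin n))) :=
    determinedBy_readOff (↑E : Set (Sym2 (Fin n))) (fun ξ => ∀ a ∈ A, ¬ (openGraph ξ).Reachable x a)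
  have dBs' := determinedBy_offBlock c V hdisj (Ne.symm hii') dBs
  rw [e1, e2]
  exact core_heavyLight w A j c V hcover hsep i' hy hBs_low dBs'

/-- **Row 4.**  For `x ∈ V i`, `y ∈ V i'` (`i ≠ i'`) and the cut relay `c ∈ A`:
`μ({x ↮ A} ∩ {1 ≤ N_y ≤ j, N_c > j}) ≤ μ{x ↮ A} · μ{1 ≤ N_y ≤ j, N_c > j}`. [cite: Nolin2008, §4.3 Lemma 13] -/
theorem inter_unattached_attLight_le (hcA : c ∈ A) (hcV : ∀ l, c ∉ V l)
    (hdisj : ∀ l l', l ≠ l' → Disjoint (V l) (V l'))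
    (hcover : ∀ x, x ≠ c → ∃ l, x ∈ V l)
    (hsep : ∀ l l', l ≠ l' → ∀ x ∈ V l, ∀ y ∈ V l', w s(x, y) = 0)
    (i i' : Fin d) (hii' : i ≠ i') {x y : Fin n} (hx : x ∈ V i) (hy : y ∈ V i') :
    (prodBernoulli w).real ({ω : BondConfig (Fin n) | ∀ a ∈ A, ω ∉ openConn x a} ∩ {ω : BondConfig (Fin n) |
          1 ≤ (A.filter fun a => ω ∈ openConn y a).card ∧ (A.filter fun a => ω ∈ openConn y a).card ≤ j ∧
            j < (A.filter fun a => ω ∈ openConn c a).card}) ≤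
      (prodBernoulli w).real {ω : BondConfig (Fin n) | ∀ a ∈ A, ω ∉ openConn x a} *
        (prodBernoulli w).real {ω : BondConfig (Fin n) |
          1 ≤ (A.filter fun a => ω ∈ openConn y a).card ∧ (A.filter fun a => ω ∈ openConn y a).card ≤ j ∧
            j < (A.filter fun a => ω ∈ openConn c a).card} := by
  set μ := prodBernoulli w with hμ
  haveI : IsProbabilityMeasure μ := by rw [hμ]; infer_instance
  set E : Finset (Sym2 (Fin n)) := (insert c (V i)).sym2.erase s(c, c) with hE
  set Bs : Set (BondConfig (Fin n)) := {ω | ∃ a ∈ A, (openGraph (ω ∩ ↑E)).Reachable x a} with hBs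
  set Br : Set (BondConfig (Fin n)) := {ω | ∃ a ∈ A, ω ∈ openConn x a} with hBr
  set G : Set (BondConfig (Fin n)) := {ω : BondConfig (Fin n) |
    1 ≤ (A.filter fun a => ω ∈ openConn y a).card ∧ (A.filter fun a => ω ∈ openConn y a).card ≤ j ∧
      j < (A.filter fun a => ω ∈ openConn c a).card} with hGdef
  have hiff : ∀ ω : BondConfig (Fin n), (∀ e ∈ ω, w e ≠ 0) → (ω ∈ Br ↔ ω ∈ Bs) := by
    intro ω hω
    have h := unattached_iff w c V A hcA hcV hdisj hcover hsep ω hω i hx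
    simp only [hBs, hBr, mem_setOf_eq]
    constructor
    · intro hex
      by_contra hno
      push Not at hno
      obtain ⟨a, ha, hxa⟩ := hex
      exact (h.2 hno) a ha hxa
    · rintro ⟨a, ha, hxa⟩
      exact ⟨a, ha, reachable_mono inter_subset_left hxa⟩
  have e1 : μ.real Br = μ.real Bs := measureReal_congr_support w hiff
  have e2 : μ.real (Br ∩ G) = μ.real (Bs ∩ G) :=
    measureReal_congr_support w fun ω hω => by simp only [mem_inter_iff]; rw [hiff ω hω]
  have hBs_up : IsUpperSet Bs := by
    intro ω ω' hle h
    simp only [hBs, mem_setOf_eq] at h ⊢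
    obtain ⟨a, ha, hxa⟩ := h
    exact ⟨a, ha, reach_inter_mono _ hle hxa⟩
  have dBs : DeterminedBy Bs (↑E : Set (Sym2 (Fin n))) :=
    determinedBy_readOff (↑E : Set (Sym2 (Fin n))) (fun ξ => ∃ a ∈ A, (openGraph ξ).Reachable x a)
  have dBs' := determinedBy_offBlock c V hdisj (Ne.symm hii') dBs
  have hcore : μ.real Br * μ.real G ≤ μ.real (Br ∩ G) := by
    rw [e1, e2]
    exact core_attLight w A j c V hcV hdisj hcover hsep i' hy hBs_up dBs'
  have hsplit : μ.real (G ∩ Br) + μ.real (G \ Br) = μ.real G :=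
    measureReal_inter_add_sdiff MeasurableSet.of_discrete
  have hcompl : μ.real {ω : BondConfig (Fin n) | ∀ a ∈ A, ω ∉ openConn x a} = 1 - μ.real Br := by
    have h := measureReal_compl (μ := μ) (s := Br) MeasurableSet.of_discrete
    rw [probReal_univ] at h
    rw [← h]
    congr 1
    ext ω
    simp only [hBr, mem_compl_iff, mem_setOf_eq, not_exists, not_and]
  have hdiff : ({ω : BondConfig (Fin n) | ∀ a ∈ A, ω ∉ openConn x a} ∩ G) = G \ Br := by
    ext ω
    simp only [mem_inter_iff, mem_sdiff, mem_setOf_eq, hBr, not_exists, not_and]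
    tauto
  rw [hdiff, hcompl]
  rw [inter_comm] at hcore
  have hring : (1 - μ.real Br) * μ.real G = μ.real G - μ.real Br * μ.real G := by ring
  rw [hring]
  linarith [hcore, hsplit]

end Rows

end WitnessSeparated

end Summit.CriticalPhenomena.PercolationContinuityZ3.Theorems

end
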